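import Summits.SmoothPoincare4.SmoothPoincare4.Theorems.CongruenceShadowsGriffithsHandlebodyExtensionCoverSmooth
import Summits.SmoothPoincare4.SmoothPoincare4.Theorems.CongruenceShadowsGriffithsHandlebodyExtensionCoverDescent
import HarnessLib

/-!
# SmoothPoincare4 / CongruenceShadows — `GriffithsHandlebodyExtension` (item stmt-SmoothPoincare4-15190): assembly: (E) from the planar family (E3)

Support file (`--supports` stmt-SmoothPoincare4-15190) of the homothety-cover proof of the genus-one
clause (E) of Griffiths' handlebody extension theorem — *every self-diffeomorphism of the Heegaard torus
`∂V` of the round solid torus fixing the base point and acting trivially on `π₁(∂V)` extends to a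
self-diffeomorphism of `V`* (hypothesis `hE` of
`Literature.Topology.FourManifolds.RoundSolidTorusModel.diffeoExtends_of_map_ker_eq_ker_of_forall_diffeoExtends`).
See the module docstring of `…CoverDefs` for the whole line (E1–E6) and the notation
(`τ̂`, `δ_λ`, `ρ`, `χ`, `f`, `Δ^(c)`, `α`, `L`, `M`, `Ψ̂`, `ẽ_c`).

This part: the interface between the cover core and the planar step — `PlanarInput` (an equivariant pair of mutually
inverse planar maps smooth off the origin), `PlanarInput.HasFamily` (the log-periodic planar family, E3),
`PlanarInput.coreData`, the planar input `planarInputOfBoundary` of a boundary diffeomorphism (its lift `τ̂`), and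
`forall_diffeoExtends_of_hasFamily`: (E3) for every planar input implies (E).
-/

-- the registered namespace `Summit.SmoothPoincare4.SmoothPoincare4.Theorems` repeats a component
set_option linter.dupNamespace false

noncomputable section

namespace Summit.SmoothPoincare4.SmoothPoincare4.Theorems

namespace HomothetyCover

open Set Function Metric Filter
open scoped Topology ContDiff

section Assembly

open Literature.Topology.FourManifolds Literature.Topology.FourManifolds.RoundSolidTorusModel
open scoped Manifold

/-- **Input of the planar step (E3)**: an equivariant pair of mutually inverse planar maps fixing
the origin and smooth off it — the shape of the lifted boundary diffeomorphism `τ̂` and its inverse. -/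
structure PlanarInput (lam : ℝ) where
  /-- the lifted diffeomorphism, extended by `0 ↦ 0` -/
  τ : E2 → E2
  /-- its inverse -/
  τ' : E2 → E2
  /-- `τ 0 = 0` -/
  τ_zero : τ 0 = 0
  /-- `τ' 0 = 0` -/
  τ'_zero : τ' 0 = 0
  /-- `τ` is smooth off the origin -/
  contDiffAt_τ : ∀ y, y ≠ 0 → ContDiffAt ℝ ∞ τ y
  /-- `τ'` is smooth off the origin -/
  contDiffAt_τ' : ∀ y, y ≠ 0 → ContDiffAt ℝ ∞ τ' y
  /-- `τ' ∘ τ = id` -/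
  τ'_τ : ∀ y, τ' (τ y) = y
  /-- `τ ∘ τ' = id` -/
  τ_τ' : ∀ y, τ (τ' y) = y
  /-- equivariance under the deck homothety -/
  τ_smul : ∀ y, τ (lam • y) = lam • τ y

/-- **Output of the planar step (E3)**: a log-periodic smooth family of planar embeddings `ẽ_c`
with fibrewise inverses, equal to `δ_c⁻¹ τ δ_c` on the unit circle and mapping the closed unit disc
onto `δ_c⁻¹ τ (D̄)` — exactly the `e`-fields of `CoreData`. -/
def PlanarInput.HasFamily {lam : ℝ} (P : PlanarInput lam) : Prop :=
  ∃ (R₁ : ℝ) (e e' : ℝ → E2 → E2), 1 < R₁ ∧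
    (∀ c, 0 < c → ∀ u : E2, ‖u‖ < R₁ → ContDiffAt ℝ ∞ (uncurry e) (c, u)) ∧
    (∀ c, 0 < c → ∀ u : E2, ‖u‖ < R₁ → e' c (e c u) = u) ∧
    (∀ c, 0 < c → ∀ u : E2, ‖u‖ < R₁ → ContDiffAt ℝ ∞ (uncurry e') (c, e c u)) ∧
    (∀ c, 0 < c → ∀ u : E2, ‖u‖ < R₁ → e (lam * c) u = e c u) ∧
    (∀ c, 0 < c → ∀ u : E2, ‖u‖ = 1 → e c u = c⁻¹ • P.τ (c • u)) ∧
    (∀ c, 0 < c → e c '' closedBall (0 : E2) 1 = {w | w = 0 ∨ ‖P.τ' (c • w)‖ ≤ c})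

/-- The `CoreData` assembled from a planar input with a family. -/
def PlanarInput.coreData {lam : ℝ} (hlam : 1 < lam) (P : PlanarInput lam) (hP : P.HasFamily) : CoreData where
  lam := lam
  one_lt_lam := hlam
  R₁ := hP.choose
  one_lt_R₁ := hP.choose_spec.choose_spec.choose_spec.1
  τ := P.τ
  τ' := P.τ'
  τ_zero := P.τ_zero
  τ'_zero := P.τ'_zero
  contDiffAt_τ' := P.contDiffAt_τ'
  τ'_τ := P.τ'_τ
  τ_τ' := P.τ_τ'
  τ_smul := P.τ_smul
  e := hP.choose_spec.choose
  e' := hP.choose_spec.choose_spec.choose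
  contDiffAt_e := hP.choose_spec.choose_spec.choose_spec.2.1
  e'_e := hP.choose_spec.choose_spec.choose_spec.2.2.1
  contDiffAt_e' := hP.choose_spec.choose_spec.choose_spec.2.2.2.1
  e_per := hP.choose_spec.choose_spec.choose_spec.2.2.2.2.1
  e_sphere := hP.choose_spec.choose_spec.choose_spec.2.2.2.2.2.1
  e_image := hP.choose_spec.choose_spec.choose_spec.2.2.2.2.2.2

/-- The homothety factor of the assembled `CoreData` is `λ`. -/
@[simp] theorem PlanarInput.coreData_lam {lam : ℝ} (hlam : 1 < lam) (P : PlanarInput lam) (hP : P.HasFamily) :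
    (P.coreData hlam hP).lam = lam := rfl

/-- The lifted diffeomorphism of the assembled `CoreData` is `P.τ`. -/
@[simp] theorem PlanarInput.coreData_τ {lam : ℝ} (hlam : 1 < lam) (P : PlanarInput lam) (hP : P.HasFamily) :
    (P.coreData hlam hP).τ = P.τ := rfl

/-- **The planar input of a based `π₁`-trivial boundary diffeomorphism**: its lift `τ̂` (E2). -/
def planarInputOfBoundary (lam : ℝ) (hlam : 1 < lam)
    (τV : (𝓡∂ 3).boundary RoundSolidTorus ≃ₘ⟮𝓡 2, 𝓡 2⟯ (𝓡∂ 3).boundary RoundSolidTorus)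
    (hτ : τV basePt = basePt)
    (h : ∀ γ, FundamentalGroup.mapOfEq (⟨τV, τV.continuous⟩ : C(_, _)) hτ γ = γ) : PlanarInput lam where
  τ := tauHat lam hτ
  τ' := tauHat lam (symm_basePt hτ)
  τ_zero := tauHat_zero hτ
  τ'_zero := tauHat_zero _
  contDiffAt_τ := fun _ hy => contDiffAt_tauHat hlam hτ h hy
  contDiffAt_τ' := fun _ hy => contDiffAt_tauHat hlam (symm_basePt hτ) (mapOfEq_symm_eq hτ h _) hy
  τ'_τ := fun y => tauHat_tauHat hlam hτ (symm_basePt hτ) (mapOfEq_symm_eq hτ h _)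
    (fun z => τV.symm_apply_apply z) y
  τ_τ' := fun y => tauHat_tauHat hlam (symm_basePt hτ) hτ h (fun z => τV.apply_symm_apply z) y
  τ_smul := fun y => tauHat_smul hlam hτ h y

/-- **(E) from (E3).**  If every planar input admits a planar family, then every
self-diffeomorphism of `∂V` fixing `basePt` and acting trivially on `π₁(∂V, basePt)` extends over
the round solid torus `V`: hypothesis `hE` of
`RoundSolidTorusModel.diffeoExtends_of_map_ker_eq_ker_of_forall_diffeoExtends`. -/
theorem forall_diffeoExtends_of_hasFamily (lam : ℝ) (hlam : 1 < lam)
    (hE3 : ∀ P : PlanarInput lam, P.HasFamily)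
    (τV : (𝓡∂ 3).boundary RoundSolidTorus ≃ₘ⟮𝓡 2, 𝓡 2⟯ (𝓡∂ 3).boundary RoundSolidTorus)
    (hτ : τV basePt = basePt)
    (h : ∀ γ, FundamentalGroup.mapOfEq (⟨τV, τV.continuous⟩ : C(_, _)) hτ γ = γ) :
    (BoundaryManifold.boundaryData 2 RoundSolidTorus).DiffeoExtends τV := by
  set P := planarInputOfBoundary lam hlam τV hτ h with hP
  set D := P.coreData hlam (hE3 P) with hD
  refine D.diffeoExtends_of_lift τV (fun y hy z hz => ?_)
  rw [PlanarInput.coreData_lam] at hz ⊢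
  rw [PlanarInput.coreData_τ]
  exact hlift_tauHat hlam hτ h hy z hz

end Assembly

end HomothetyCover

end Summit.SmoothPoincare4.SmoothPoincare4.Theorems

end
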